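import Summits.MatrixMultiplication.OmegaCensus.STPP211Z2pow6CoverEngine

/-!
# (2,1,1)¹⁰ ⊄ (ℤ/2)⁶ — part H3d1: the cover decisions, frames with `d = 4` (all 462) and `d = 5` (chunks 1–3 of 4; 14 950 frames in all)

Cell `pub-omega` (unit `pub-omega-stpp-1-g37`), topic `Summits/MatrixMultiplication/OmegaCensus`.
HONEST FRAMING (verbatim): lottery ticket; floor = certified bounds/negative ranges. Census STRUCTURE bookkeeping (B5, `T1((ℤ/2)⁶)`, Pb237);
nothing here is a bound on `ω`.

Kernel decisions of `coverOne` (`STPP211Z2pow6CoverEngine`) over chunks of the enumeration `(freeCodes d).sublistsLen (9 − d)` of the free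
parts of the frame normal forms (chunks sized to ≈ 1 kernel-minute); assembled in `STPP211Z2pow6Cover` (`cover_all`, `cover_spec`).

References: H. Cohn, R. Kleinberg, B. Szegedy, C. Umans, FOCS 2005 (arXiv:math/0511460), Def. 5.1.
-/

namespace Summit.MatrixMultiplication.OmegaCensus

namespace T1Z2p6

/-- KERNEL: every frame normal form with `d = 4` (462 frames, 120 orderings each) passes the cover check. -/
theorem cover4 : ((freeCodes 4).sublistsLen 5).all (coverOne 4) = true := by decide +kernel

/-- KERNEL: frames with `d = 5`, chunk 1 (frames 1 – 3 738) pass the cover check. -/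
theorem cover5a : (((freeCodes 5).sublistsLen 4).take 3738).all (coverOne 5) = true := by decide +kernel

/-- KERNEL: frames with `d = 5`, chunk 2 (frames 3 739 – 7 476) pass the cover check. -/
theorem cover5b : ((((freeCodes 5).sublistsLen 4).drop 3738).take 3738).all (coverOne 5) = true := by decide +kernel

/-- KERNEL: frames with `d = 5`, chunk 3 (frames 7 477 – 11 213) pass the cover check. -/
theorem cover5c : ((((freeCodes 5).sublistsLen 4).drop 7476).take 3737).all (coverOne 5) = true := by decide +kernel
end T1Z2p6

end Summit.MatrixMultiplication.OmegaCensus
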